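import Literature.Probability.LatticeModels.TorusFourierProofs
import Mathlib.Algebra.Group.ForwardDiff
import Mathlib.Analysis.SpecialFunctions.Trigonometric.Bounds
import Mathlib.Data.ZMod.ValMinAbs
import HarnessLib

/-!
# Discrete derivatives of lattice Fourier transforms are bounded by torus moments

Topic `Literature/Probability/LatticeModels`; companion of `TorusFourier(Proofs).lean` (the characters `χ_k(x)` of
`(ℤ/Lℤ)^d`).  Benfatto–Giuliani–Mastropietro 2006, (2.36aa) and (3.3): on the finite torus the smoothness of a
momentum-space function `Ŵ(k) = Σ_x χ_k(x) W(x)` is measured by the DISCRETE derivatives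
`∂_{k_j} Ŵ(k) = (L/2π)[Ŵ(k + (2π/L)e_j) - Ŵ(k)]`, and `∂^n Ŵ` is the Fourier transform of `(ix)ⁿ W(x)`, hence bounded
by the position-space moments `Σ_x |x|ⁿ |W(x)|` (with the minimal representatives `|x_j| ≤ L/2` of the periodic
coordinates) — the dictionary by which the decay-weighted kernel norms of the renormalisation-group step
(`GrassmannWeightedEffectiveActionBound.lean`; weights `(1 + γ^h diam)^N` dominate the moments) control the
smoothness of the dressed dispersion relation `E_h(k)`, (2.36).  Proved here, for vector-valued `W` and any list of
directions:

* `torusChar_add_left`, `torusChar_single_left` (`χ_{e_j}(x) = e(x_j)`), `norm_stdAddChar_sub_one_le_div`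
  (`‖e(a) - 1‖ ≤ 2π|ã|/L`, `ã` the minimal representative `ZMod.valMinAbs a`);
* `foldr_fwdDiff_sum_torusChar_smul` — the iterated forward differences `Δ_{e_{j₁}} ⋯ Δ_{e_{jₙ}}` of
  `k ↦ Σ_x χ_k(x) • W(x)` are `Σ_x χ_k(x) ∏ᵢ (e(x_{jᵢ}) - 1) • W(x)`;
* **`norm_foldr_fwdDiff_sum_torusChar_smul_le`** — hence bounded by `Σ_x ∏ᵢ (2π|x̃_{jᵢ}|/L) ‖W(x)‖`
  (the normalised discrete derivatives `(L/2π)ⁿ Δⁿ` by the moments `Σ_x ∏ᵢ |x̃_{jᵢ}| ‖W(x)‖`, uniformly in `L`).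

Everything is proved; no definitions, no named facts. [folklore]

## Sources

G. Benfatto, A. Giuliani, V. Mastropietro, Ann. Henri Poincaré 7 (2006) 809–898, (2.36), (2.36aa), (3.3)
(`BenfattoGiulianiMastropietro2006`); S. Friedli, Y. Velenik, *Statistical Mechanics of Lattice Systems* (2017), §10.4
(lattice Fourier analysis) (`FriedliVelenik2017`).
-/

noncomputable section

open Finset Complex
open scoped Real

namespace Literature.Probability.LatticeModels

variable {d L : ℕ} [NeZero L]

/-! ### One difference: the multiplier `e(x_j) - 1` -/

/-- `χ_{k + k'}(x) = χ_k(x) χ_{k'}(x)`. [folklore] -/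
theorem torusChar_add_left (k k' x : TorusSite d L) : torusChar (k + k') x = torusChar k x * torusChar k' x := by
  rw [torusChar_comm, torusChar_add_right, torusChar_comm x k, torusChar_comm x k']

/-- **The character of a unit step**: `χ_{e_j}(x) = e(x_j)`. [folklore] -/
theorem torusChar_single_left (j : Fin d) (x : TorusSite d L) :
    torusChar (Pi.single j (1 : ZMod L)) x = ZMod.stdAddChar (x j) := by
  rw [torusChar, Finset.prod_eq_single j]
  · rw [Pi.single_eq_same, one_mul]
  · intro i _ hi
    rw [Pi.single_eq_of_ne hi, zero_mul, AddChar.map_zero_eq_one]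
  · exact fun h => absurd (mem_univ j) h

/-- **`‖e(a) - 1‖ ≤ 2π|ã|/L`** with `ã = ZMod.valMinAbs a` the minimal representative (`|ã| ≤ L/2`): the chord is
shorter than the arc. [folklore] -/
theorem norm_stdAddChar_sub_one_le_div (a : ZMod L) :
    ‖(ZMod.stdAddChar a : ℂ) - 1‖ ≤ 2 * π * |(a.valMinAbs : ℝ)| / L := by
  have hL : (0 : ℝ) < L := Nat.cast_pos.2 (Nat.pos_of_ne_zero (NeZero.ne L))
  have ha : (ZMod.stdAddChar a : ℂ) = Complex.exp (Complex.I * ((2 * π * (a.valMinAbs : ℝ) / L : ℝ) : ℂ)) := by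
    conv_lhs => rw [← ZMod.coe_valMinAbs a, ZMod.stdAddChar_coe]
    congr 1
    push_cast
    ring
  rw [ha]
  refine Real.norm_exp_I_mul_ofReal_sub_one_le.trans (le_of_eq ?_)
  rw [Real.norm_eq_abs, abs_div, abs_mul, abs_of_pos hL, abs_of_pos (by positivity : (0 : ℝ) < 2 * π)]

/-! ### Iterated differences of a character sum -/

variable {E : Type*} [NormedAddCommGroup E] [NormedSpace ℂ E]

/-- **Iterated forward differences of a character sum**: for every list of directions,
`(Δ_{e_{j₁}} ⋯ Δ_{e_{jₙ}}) (k ↦ Σ_x χ_k(x) • W x) = k ↦ Σ_x (χ_k(x) ∏ᵢ (e(x_{jᵢ}) - 1)) • W x`. [folklore] -/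
theorem foldr_fwdDiff_sum_torusChar_smul (js : List (Fin d)) (W : TorusSite d L → E) :
    js.foldr (fun j g => fwdDiff (Pi.single j (1 : ZMod L)) g) (fun k => ∑ x, torusChar k x • W x) =
      fun k => ∑ x, (torusChar k x * (js.map fun j => (ZMod.stdAddChar (x j) : ℂ) - 1).prod) • W x := by
  induction js with
  | nil => funext k; simp
  | cons j js ih =>
    rw [List.foldr_cons, ih]
    funext k
    simp only [fwdDiff, List.map_cons, List.prod_cons, ← Finset.sum_sub_distrib, ← sub_smul]
    refine sum_congr rfl fun x _ => ?_
    rw [torusChar_add_left, torusChar_single_left]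
    ring_nf

omit [NeZero L] in
/-- Monotonicity of list products of nonnegative reals under termwise bounds. [folklore] -/
theorem prod_map_le_prod_map_of_nonneg {ι : Type*} (l : List ι) (f g : ι → ℝ) (hf : ∀ i, 0 ≤ f i) (hfg : ∀ i, f i ≤ g i) :
    (l.map f).prod ≤ (l.map g).prod := by
  induction l with
  | nil => simp
  | cons i l ih =>
    rw [List.map_cons, List.map_cons, List.prod_cons, List.prod_cons]
    have h0 : 0 ≤ (l.map f).prod := List.prod_nonneg fun r hr => by
      obtain ⟨i', -, rfl⟩ := List.mem_map.1 hr; exact hf i'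
    exact mul_le_mul (hfg i) ih h0 ((hf i).trans (hfg i))

/-- **Discrete derivatives of lattice Fourier transforms are bounded by torus moments** (Benfatto–Giuliani–
Mastropietro 2006, (2.36aa)/(3.3)): for every list of directions `j₁, …, jₙ` and every `k`,
`‖(Δ_{e_{j₁}} ⋯ Δ_{e_{jₙ}}) (Σ_x χ_·(x) • W x) (k)‖ ≤ Σ_x ∏ᵢ (2π|x̃_{jᵢ}|/L) ‖W x‖`, i.e. the normalised discrete
derivatives `(L/2π)ⁿ Δⁿ Ŵ` are bounded by the `n`-th moments of `W` in the minimal representatives `|x̃_j| ≤ L/2`,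
uniformly in `L`. [cite: BenfattoGiulianiMastropietro2006, (2.36aa) and (3.3)] -/
theorem norm_foldr_fwdDiff_sum_torusChar_smul_le (js : List (Fin d)) (W : TorusSite d L → E) (k : TorusSite d L) :
    ‖js.foldr (fun j g => fwdDiff (Pi.single j (1 : ZMod L)) g) (fun k => ∑ x, torusChar k x • W x) k‖ ≤
      ∑ x, (js.map fun j => 2 * π * |(((x j).valMinAbs : ℤ) : ℝ)| / L).prod * ‖W x‖ := by
  rw [foldr_fwdDiff_sum_torusChar_smul]
  refine (norm_sum_le _ _).trans (sum_le_sum fun x _ => ?_)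
  rw [norm_smul, norm_mul, norm_torusChar, one_mul]
  refine mul_le_mul_of_nonneg_right ?_ (norm_nonneg _)
  rw [List.norm_prod, List.map_map]
  exact prod_map_le_prod_map_of_nonneg js _ _ (fun j => norm_nonneg _) fun j => norm_stdAddChar_sub_one_le_div (x j)

end Literature.Probability.LatticeModels
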